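import Summits.CriticalPhenomena.PercolationContinuityZ3.Theorems.PercNearOneGluingNoHeavyLowerTailCubicFourPointL1CertRows
import Summits.CriticalPhenomena.PercolationContinuityZ3.Theorems.PercNearOneGluingNoHeavyLowerTailCubicFourPointL1Cert
import Summits.CriticalPhenomena.PercolationContinuityZ3.Theorems.PercNearOneGluingNoHeavyLowerTailCubicFourPointL1Relabel
import HarnessLib

/-!
# (L1) from prim-facecert's 261-row certificate: assembly of the `FourPointCert` replay (a second, independent derivation)

Prover prim-l12-p2 (`--supports stmt-CriticalPhenomena-4575`).  No sorries, no named facts; the certificate identity is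
decided by `native_decide` (`FourPointCert.cert_checkN`, `…L1Cert`; COMPUTATIONAL ancestry `Lean.ofReduceBool` — the pure-kernel form of the same check exceeds the gate's elaboration budget).  Assembly of the replay of prim-facecert's exact degree-5 certificate of (L1) over
THEOREM rows (Harris ×234, Gladkov strong Harris–Kleitman ×7 (AG ×5, SF ×2), SHK3⁺ = 3PT-LB ×2, hybrid 3PT-LB ×6, cells ×12; region
`«a|b|cy» ≤ «a|by|c»`, the other half by the `b ↔ c` symmetry of (L1)):
* `certBlocks_valid` (decide): every row of the certificate satisfies the decidable validity conditions of `…L1CertRows`, hence is ≥ 0 on the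
  cell law of every weighted graph (`rowVal_nonneg_of_valid`); `certM_squares`: the multiplier contains every square with positive coefficient;
* `L1hom_cellLaw_nonneg`: `0 ≤ L1hom (cellLaw a b c y w)` for every finite `V`, weights `w`, labels `a b c y` (coincidences allowed);
* `l1W_univ_eq_L1hom`: p2's `l1W univ w ∅ a b c y` is `L1hom` of the cell law (via bnk-1's `l1W_univ_eq_sahiE3`); `l1W_univ_nonneg_cert`.
NOTE: prim-cert-2's KERNEL replay of prim-l12-p6's sparser 16-row certificate (`L1ThmCert.polarisedRowL1`, landed 30 min earlier) is the primary
proof of (L1); `…CubicFourPointL1AllSystems` derives `L1Conj` for every system from it.  This file is an independent cross-check through a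
different certificate (Harris ×234 + Gladkov + 3PT-LB + hybrid rows) and a different dictionary.
-/

namespace Summit.CriticalPhenomena.PercolationContinuityZ3.Theorems

namespace FourPointCert

open MeasureTheory Finset SimpleGraph Literature.Probability.Percolation Literature.Probability.LatticeModels CubicFourPointL1
open scoped Classical

/-! ### The certificate data passes the decidable checks -/

set_option maxRecDepth 100000 in
/-- Every row of the certificate is valid and every block well formed. [this work] -/
theorem certBlocks_valid : (certBlocks.all fun blk => blk.row.valid && blk.wf) = true := by
  decide +kernel

set_option maxRecDepth 100000 in
/-- The multiplier's monomials are cells. [this work] -/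
theorem certM_wf : (certM.all fun t => t.2.all fun i => decide (i < 15)) = true := by
  decide +kernel

set_option maxRecDepth 100000 in
/-- Every square `xᵢ²` of a cell where `b` is joined to something occurs in the multiplier with a positive coefficient (the multiplier
vanishes exactly on the `b`-isolated face). [this work] -/
theorem certM_squares :
    ((List.range 15).all fun i => !bJoined i || certM.any fun t => t.2 == [i, i] && decide (0 < t.1)) = true := by
  decide +kernel

/-- `certM_wf` unpacked. [this work] -/
theorem certM_wf' : ∀ t ∈ certM, ∀ i ∈ t.2, i < 15 := by
  have h := certM_wf
  simp only [List.all_eq_true, decide_eq_true_eq] at h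
  exact h

/-- `certM_squares` unpacked. [this work] -/
theorem certM_squares' {i : ℕ} (hi : i < 15) (hb : bJoined i = true) : ∃ c, 0 < c ∧ (c, [i, i]) ∈ certM := by
  have h := certM_squares
  simp only [List.all_eq_true, List.mem_range, Bool.or_eq_true, Bool.not_eq_true', List.any_eq_true, Bool.and_eq_true, beq_iff_eq,
    decide_eq_true_eq] at h
  rcases h i hi with h | ⟨t, ht, h2, h1⟩
  · rw [hb] at h; exact absurd h (by simp)
  · refine ⟨t.1, h1, ?_⟩
    have : t = (t.1, [i, i]) := by rw [← h2]
    rw [← this]; exact ht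

/-- `certBlocks_valid` unpacked: validity. [this work] -/
theorem certBlocks_valid' : ∀ blk ∈ certBlocks, blk.row.valid = true := by
  have h := certBlocks_valid
  simp only [List.all_eq_true, Bool.and_eq_true] at h
  exact fun blk hb => (h blk hb).1

/-- `certBlocks_valid` unpacked: well-formedness. [this work] -/
theorem certBlocks_wf' : ∀ blk ∈ certBlocks, blk.wf = true := by
  have h := certBlocks_valid
  simp only [List.all_eq_true, Bool.and_eq_true] at h
  exact fun blk hb => (h blk hb).2

/-- **The certificate inequality** `M(x)·L1hom(x) ≥ 0` for nonnegative cells with `x 1 ≤ x 2` and nonnegative rows, from the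
(computationally decided) identity `cert_checkN`. [this work] -/
theorem polyVal_mul_L1hom_nonneg_cert (x : ℕ → ℝ) (hx : ∀ i, 0 ≤ x i) (hreg : x 1 ≤ x 2)
    (hrows : ∀ blk ∈ certBlocks, 0 ≤ rowVal blk.row x) : 0 ≤ polyVal certM x * L1hom x := by
  have h := denote_eq_of_checkN (ctxOf x) cert_checkN
  rw [denote_mul, denote_polyE x certM certM_wf', denote_l1E, denote_certE x certBlocks certBlocks_wf'] at h
  rw [h]
  exact certVal_nonneg x certBlocks hx hreg hrows

/-! ### (L1) on the cell law of every weighted graph -/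

variable {V : Type*}

/-- `msum` depends only on the first 15 values. [this work] -/
theorem msum_congr {x x' : ℕ → ℝ} (h : ∀ i < 15, x i = x' i) (T : ℕ) : msum T x = msum T x' :=
  Finset.sum_congr rfl fun i hi => by rw [h i (Finset.mem_range.1 hi)]

/-- `L1hom` depends only on the first 15 values. [this work] -/
theorem L1hom_congr {x x' : ℕ → ℝ} (h : ∀ i < 15, x i = x' i) : L1hom x = L1hom x' := by
  simp only [L1hom, e3val, msum_congr h, h 7 (by norm_num)]

variable [Fintype V] [DecidableEq V] (w : Sym2 V → unitInterval) (a b c y : V)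

/-- (L1) in the region `«a|b|cy» ≤ «a|by|c»`, straight from the certificate (plus the `b`-isolated face, where it vanishes). [this work] -/
theorem L1hom_nonneg_of_region (hreg : cellLaw a b c y w 1 ≤ cellLaw a b c y w 2) : 0 ≤ L1hom (cellLaw a b c y w) := by
  have hx : ∀ i, 0 ≤ cellLaw a b c y w i := cellLaw_nonneg a b c y w
  by_cases hface : ∀ i, bJoined i = true → cellLaw a b c y w i = 0
  · rw [L1hom_eq_zero_of_bIsolated _ hface]
  simp only [not_forall, exists_prop] at hface
  obtain ⟨i, hbi, hxi⟩ := hface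
  have hi : i < 15 := by
    by_contra hi
    refine hxi ?_
    unfold cellLaw
    have : pat a b c y ⁻¹' {i} = ∅ := by
      ext ω; simp only [Set.mem_preimage, Set.mem_singleton_iff, Set.mem_empty_iff_false, iff_false]
      exact fun h => hi (h ▸ pat_lt a b c y ω)
    rw [this, measureReal_empty]
  obtain ⟨c', hc', hcM⟩ := certM_squares' hi hbi
  have hM : 0 < polyVal certM (cellLaw a b c y w) :=
    polyVal_pos_of_square _ certM hx (lt_of_le_of_ne (hx i) (Ne.symm hxi)) hc' hcM
  have hprod := polyVal_mul_L1hom_nonneg_cert (cellLaw a b c y w) hx hreg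
    (fun blk hb => rowVal_nonneg_of_valid a b c y blk.row (certBlocks_valid' blk hb) w)
  by_contra hneg
  rw [not_le] at hneg
  exact absurd hprod (not_le.2 (mul_neg_of_pos_of_neg hM hneg))

/-- **(L1) on the cell law of every weighted graph**: `0 ≤ L1hom (cellLaw a b c y w)`. [this work] -/
theorem L1hom_cellLaw_nonneg : 0 ≤ L1hom (cellLaw a b c y w) := by
  rcases le_total (cellLaw a b c y w 1) (cellLaw a b c y w 2) with h | h
  · exact L1hom_nonneg_of_region w a b c y h
  · have h' : cellLaw a c b y w 1 ≤ cellLaw a c b y w 2 := by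
      rw [cellLaw_swap a b c y w (show 1 < 15 by norm_num), cellLaw_swap a b c y w (show 2 < 15 by norm_num)]
      exact h
    have h2 := L1hom_nonneg_of_region w a c b y h'
    rw [L1hom_congr (fun i hi => cellLaw_swap a b c y w hi), L1hom_perm] at h2
    exact h2

/-! ### Bridge to p2's `l1W` -/

omit [Fintype V] in
/-- The label set `{a, y}` (mask `9`). [this work] -/
theorem labSet_nine : labSet a b c y 9 = {a, y} := by
  ext v
  have h9 : ∀ u < 4, (9 : ℕ).testBit u = true ↔ u = 0 ∨ u = 3 := by decide
  simp only [labSet, Finset.mem_image, Finset.mem_filter, Finset.mem_range, Finset.mem_insert, Finset.mem_singleton]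
  constructor
  · rintro ⟨u, ⟨hu, ht⟩, rfl⟩
    rcases (h9 u hu).1 ht with rfl | rfl
    · exact Or.inl rfl
    · exact Or.inr rfl
  · rintro (rfl | rfl)
    · exact ⟨0, ⟨by norm_num, (h9 0 (by norm_num)).2 (Or.inl rfl)⟩, rfl⟩
    · exact ⟨3, ⟨by norm_num, (h9 3 (by norm_num)).2 (Or.inr rfl)⟩, rfl⟩

omit [Fintype V] in
/-- Separation of two single labels as a mask event. [this work] -/
theorem compl_openConn_eq_pre {u v : ℕ} (hu : u < 4) (hv : v < 4) :
    (openConn (lab a b c y u) (lab a b c y v))ᶜ = pre a b c y (gsepMask (2 ^ u) (2 ^ v)) := by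
  ext ω; rw [mem_pre_gsepMask, labSet_two_pow a b c y hu, labSet_two_pow a b c y hv]; simp

omit [Fintype V] in
/-- Separation of `{a, y}` from one label as a mask event. [this work] -/
theorem compl_inter_compl_eq_pre {v : ℕ} (hv : v < 4) :
    (openConn a (lab a b c y v))ᶜ ∩ (openConn y (lab a b c y v))ᶜ = pre a b c y (gsepMask 9 (2 ^ v)) := by
  ext ω; rw [mem_pre_gsepMask, labSet_nine, labSet_two_pow a b c y hv]; simp

omit [Fintype V] [DecidableEq V] in
/-- The cell `a|bcy` as the preimage of pattern `7`. [this work] -/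
theorem cellA_eq_preimage : openConn b c ∩ (openConn a b)ᶜ ∩ openConn b y = pat a b c y ⁻¹' {7} := by
  have j7 : joined 7 0 = false ∧ joined 7 1 = false ∧ joined 7 2 = false ∧ joined 7 3 = true ∧ joined 7 4 = true ∧ joined 7 5 = true := by
    decide
  ext ω
  have j0 := joined_pat a b c y ω (show 0 < 6 by norm_num)
  have j1 := joined_pat a b c y ω (show 1 < 6 by norm_num)
  have j2 := joined_pat a b c y ω (show 2 < 6 by norm_num)
  have j3 := joined_pat a b c y ω (show 3 < 6 by norm_num)
  have j4 := joined_pat a b c y ω (show 4 < 6 by norm_num)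
  have j5 := joined_pat a b c y ω (show 5 < 6 by norm_num)
  simp only [bitOf, cb, lab] at j0 j1 j2 j3 j4 j5
  simp only [Set.mem_inter_iff, Set.mem_compl_iff, Set.mem_preimage, Set.mem_singleton_iff]
  constructor
  · rintro ⟨⟨hbc, hab⟩, hby⟩
    refine pat_ext _ (pat_lt a b c y ω) 7 (by norm_num) fun k hk => ?_
    have hac : ω ∉ openConn a c := fun h => hab (h.trans (SimpleGraph.Reachable.symm hbc))
    have hay : ω ∉ openConn a y := fun h => hab (h.trans (SimpleGraph.Reachable.symm hby))
    have hcy : ω ∈ openConn c y := (SimpleGraph.Reachable.symm hbc).trans hby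
    interval_cases k
    · rw [j0, j7.1]; exact decide_eq_false hab
    · rw [j1, j7.2.1]; exact decide_eq_false hac
    · rw [j2, j7.2.2.1]; exact decide_eq_false hay
    · rw [j3, j7.2.2.2.1]; exact decide_eq_true hbc
    · rw [j4, j7.2.2.2.2.1]; exact decide_eq_true hby
    · rw [j5, j7.2.2.2.2.2]; exact decide_eq_true hcy
  · intro h
    have h0 := j0; have h3 := j3; have h4 := j4
    rw [h] at h0 h3 h4
    rw [j7.1] at h0; rw [j7.2.2.2.1] at h3; rw [j7.2.2.2.2.1] at h4
    exact ⟨⟨of_decide_eq_true h3.symm, of_decide_eq_false h0.symm⟩, of_decide_eq_true h4.symm⟩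

/-- **p2's `l1W` over all coordinates is `L1hom` of the cell law.** [this work] -/
theorem l1W_univ_eq_L1hom : l1W Finset.univ (fun e => (w e : ℝ)) ∅ a b c y = L1hom (cellLaw a b c y w) := by
  rw [l1W_univ_eq_sahiE3 w a b c y]
  have eb : (openConn b c)ᶜ = pre a b c y (gsepMask 2 4) := compl_openConn_eq_pre a b c y (u := 1) (v := 2) (by norm_num) (by norm_num)
  have eac : (openConn a c)ᶜ = pre a b c y (gsepMask 1 4) := compl_openConn_eq_pre a b c y (u := 0) (v := 2) (by norm_num) (by norm_num)
  have eab : (openConn a b)ᶜ = pre a b c y (gsepMask 1 2) := compl_openConn_eq_pre a b c y (u := 0) (v := 1) (by norm_num) (by norm_num)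
  have gab : (openConn a b)ᶜ ∩ (openConn y b)ᶜ = pre a b c y (gsepMask 9 2) := compl_inter_compl_eq_pre a b c y (v := 1) (by norm_num)
  have gac : (openConn a c)ᶜ ∩ (openConn y c)ᶜ = pre a b c y (gsepMask 9 4) := compl_inter_compl_eq_pre a b c y (v := 2) (by norm_num)
  rw [cellA_eq_preimage, gab, gac, eb, eac, eab, sahiE3_def, sahiE3_def]
  simp only [← pre_and, real_pre]
  rw [show (prodBernoulli w).real (pat a b c y ⁻¹' {7}) = cellLaw a b c y w 7 from rfl]
  simp only [L1hom, e3val, msum_full_cellLaw]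
  ring

/-! ### Cross-check: (L1) over all coordinates from this (second, computational) derivation -/

/-- **(L1) over all coordinates**, from prim-facecert's certificate replayed by the `FourPointCert` checker (COMPUTATIONAL ancestry via
`cert_checkN`); the kernel-only route is `CubicFourPointL1.l1W_nonneg` of `…L1AllSystems` (via prim-cert-2's `L1ThmCert.polarisedRowL1`). [this work] -/
theorem l1W_univ_nonneg_cert : 0 ≤ l1W Finset.univ (fun e => (w e : ℝ)) ∅ a b c y := by
  rw [l1W_univ_eq_L1hom]; exact L1hom_cellLaw_nonneg w a b c y

end FourPointCert

end Summit.CriticalPhenomena.PercolationContinuityZ3.Theorems
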